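import Summits.AtomisticToContinuum.Crystallization.Theorems.FrustratedLawDichotomyAperiodicGapRecordJunctionReserve

/-!
# FrustratedLawDichotomy · crux `AperiodicFrustratedLawGap` (stmt-AtomisticToContinuum-27623) — the E-spine at TWO FLOORS (fcc level ≠ hcp level) and the
# core-side reserve TYPED PER LATTICE (decomp-a2c hand 2, generation 38; structural share, DEF-FREE)

The landed E-spine forgets the lattice type: `…HomPrunedPolar.homFloor_of_prunedBoxSums_selfAdjoint` and every consumer (`homFloor_of_verdictTrees`,
`homFloor_625_of_entryTrees6RBKP_…`) take the fcc half and the hcp half AT THE SAME FLOOR `m` and return `HomFloor m` over ALL admissible homogeneous instances.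
The reserve lever of `…RecordJunctionReserve` (critic rows 1436 (B)(3) / 1437 (E)) is therefore UNIFORM in the lattice type, and its kernel-free value is hcp-LIMITED
(hand-2 g38 FINDING RESERVE: fcc binding hosts have far tails `≤ −6.5e-4`, hcp binding hosts only `−4.0…−5.0e-4`).  Critic row 1437 (E)(1)(b)/(2): «SPLIT floors
`r_F ≈ 6.5e-4` / `r_H ≈ 4.0e-4` (E-spine at two floors, untyped)».  This module types it, DEF-FREE, by re-running the last two steps of the E-spine
(`prunedBoxSum_fcc/hcp_reduction` + `ballAvg_xRec_eq_latticeSum_fcc/hcp` + `latticeSum_…_eq_boxSum_record`) WITHOUT forgetting the type: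

* §1 ★ `typedFloor_of_prunedBoxSums_selfAdjoint` — fcc half at floor `m_F`, hcp half at floor `m_H` (the two hypotheses of `homFloor_of_prunedBoxSums_selfAdjoint` with
  different floors) ⟹ the TYPED FLOOR «every admissible homogeneous instance realised by an fcc ball of `G` scores `≥ m_F`, by an hcp ball of `(G, ξ)` scores `≥ m_H`»
  (stated inline); `homFloor_min_of_typedFloor` (the untyped floor `min m_F m_H` back);
* §2 ★ `homCoreFloor_of_typedFloor_of_typedGradedCredit` — typed floor `(m_F, m_H)` + TYPED graded tail credit «fcc-realised: tail ≤ −τ_F ∨ m′ ≤ score; hcp-realised: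
  tail ≤ −τ_H ∨ m′ ≤ score» + `m′ ≤ m_F + τ_F`, `m′ ≤ m_H + τ_H` ⟹ `HomCoreFloor ρ m′` (`ρ ≥ 17/5`);
* §3 ★★ `typedFloor_of_entryTreesHTA2QQDCRS3_splitLevel` — fcc ∃-tree over `entryLeafOK6RBKP μ_F` (`2 (m_F + e_W) SC ≤ μ_F`) and hcp ∃-tree over `entryLeafOKHT4A2QQDCRS3 μ_H`
  (`2 (m_H + e_W) SC ≤ μ_H`) ⟹ the typed floor; `homFloor_min_of_entryTreesHTA2QQDCRS3_splitLevel`;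
* §4 ★★★ `aperiodicFrustratedLawGap_of_entryTreesHTA2QQDCRS3_splitLevel_of_typedGradedCredit_of_coreOff_tubeTail` (generic T-dials, in-tube tail, seam `A + μT ≤ m′`) and the
  record designate `…_splitReserve_record` (`r_F`, `r_H`, `μ_F`, `μ_H` symbolic: H certifies `1/625 − r_F` on the fcc half and `1/625 − r_H` on the hcp half; the ten record
  T-leaves verbatim) with the numeral instance `(r_F, r_H) = (13/25000, 1/2500)` at the certified levels `μ₅₂ / μ₄₀` of `…Reserve` §4/§5 (`example`).

0 sorry; no definitions; no `native_decide`.  `--supports stmt-AtomisticToContinuum-27623`.  [folklore]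
-/

noncomputable section

namespace Summit.AtomisticToContinuum.Crystallization.Theorems.FrustratedLawDichotomyAperiodicGapRecordJunctionSplitLevel

open scoped BigOperators RealInnerProductSpace
open Literature.Analysis.ValidatedNumerics.Numerics
open Literature.Barriers.AtomisticToContinuum.FlatleyTheil2015 (fccVec)
open Summit.AtomisticToContinuum.Crystallization.Theorems.ChargedEnergyGapNegative (eStar)
open Summit.AtomisticToContinuum.Crystallization.Theorems.FrustratedLawDichotomyRangeCut
open Summit.AtomisticToContinuum.Crystallization.Theorems.FrustratedLawDichotomySchurCut
open Summit.AtomisticToContinuum.Crystallization.Theorems.FrustratedLawDichotomyMotifLemmas (GoodAtScale)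
open Summit.AtomisticToContinuum.Crystallization.Theorems.FrustratedLawDichotomyAveragingCut
open Summit.AtomisticToContinuum.Crystallization.Theorems.FrustratedLawDichotomyAveragingRuleTightFree (TightNearCap BadNearCap)
open Summit.AtomisticToContinuum.Crystallization.Theorems.FrustratedLawDichotomyExemptAbsorption (ExemptNear)
open Summit.AtomisticToContinuum.Crystallization.Theorems.FrustratedLawDichotomyExemptLocOpt (LocOptFails)
open Summit.AtomisticToContinuum.Crystallization.Theorems.FrustratedLawDichotomyExemptSplit (SchurElasticPricingX)
open Summit.AtomisticToContinuum.Crystallization.Theorems.FrustratedLawDichotomyExemptAbsorptionRecord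
open Summit.AtomisticToContinuum.Crystallization.Theorems.FrustratedLawDichotomyCollarCensus
open Summit.AtomisticToContinuum.Crystallization.Theorems.FrustratedLawDichotomyCollarCensusKappa
open Summit.AtomisticToContinuum.Crystallization.Theorems.FrustratedLawDichotomyStrainedPatchHomSplit
open Summit.AtomisticToContinuum.Crystallization.Theorems.FrustratedLawDichotomyStrainedPatchHomLattice
open Summit.AtomisticToContinuum.Crystallization.Theorems.FrustratedLawDichotomyStrainedPatchHomLatticeBox
open Summit.AtomisticToContinuum.Crystallization.Theorems.FrustratedLawDichotomyStrainedPatchHomLatticeBoxHcp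
open Summit.AtomisticToContinuum.Crystallization.Theorems.FrustratedLawDichotomyStrainedPatchHomIsometry
open Summit.AtomisticToContinuum.Crystallization.Theorems.FrustratedLawDichotomyStrainedPatchCleanCollar
open Summit.AtomisticToContinuum.Crystallization.Theorems.FrustratedLawDichotomyStrainedPatchPhaseCut
open Summit.AtomisticToContinuum.Crystallization.Theorems.FrustratedLawDichotomyStrainedPatchCoreTube
open Summit.AtomisticToContinuum.Crystallization.Theorems.FrustratedLawDichotomyStrainedPatchCoreTubeRecord
open Summit.AtomisticToContinuum.Crystallization.Theorems.FrustratedLawDichotomyStrainedPatchHomCertTree (CertTree treeOK)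
open Summit.AtomisticToContinuum.Crystallization.Theorems.FrustratedLawDichotomyStrainedPatchHomEntryGram (rootC rootW)
open Summit.AtomisticToContinuum.Crystallization.Theorems.FrustratedLawDichotomyStrainedPatchHomEntryGramHcp (rootCH rootWH)
open Summit.AtomisticToContinuum.Crystallization.Theorems.FrustratedLawDichotomyStrainedPatchHomEntryTable (muRec muRec_ok)
open Summit.AtomisticToContinuum.Crystallization.Theorems.FrustratedLawDichotomyStrainedPatchHomEntryTableP (entryLeafOK6RBKP entryLeafOK6RBKP_sound)
open Summit.AtomisticToContinuum.Crystallization.Theorems.FrustratedLawDichotomyStrainedPatchHomEntryTreeCert (fccHalf_of_entryTree6RBKP)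
open Summit.AtomisticToContinuum.Crystallization.Theorems.FrustratedLawDichotomyStrainedPatchHomEntryLeafHT (entryLeafOKHT4A2QQDCRS3
  entryLeafOKHT4A2QQDCRS3_sound hcpHalf_of_entryTreeHT4A2QQDCRS3)
open Summit.AtomisticToContinuum.Crystallization.Theorems.FrustratedLawDichotomyAperiodicGapRecordJunction
open Summit.AtomisticToContinuum.Crystallization.Theorems.FrustratedLawDichotomyAperiodicGapRecordJunctionVerdict
open Summit.AtomisticToContinuum.Crystallization.Theorems.FrustratedLawDichotomyAperiodicGapRecordJunctionTubeTail
open Summit.AtomisticToContinuum.Crystallization.Theorems.FrustratedLawDichotomyAperiodicGapRecordJunctionTruncated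
open Summit.AtomisticToContinuum.Crystallization.Theorems.FrustratedLawDichotomyAperiodicGapRecordJunctionTubeTailS3
open Summit.AtomisticToContinuum.Crystallization.Theorems.FrustratedLawDichotomyAperiodicGapRecordJunctionReserve
open Summit.AtomisticToContinuum.Crystallization.Theorems.FrustratedLawDichotomyPeriodicEnergyCeilingKernel (periodicEnergyCeiling_holds)

/-! ## §1 ★ The TYPED floor from the two self-adjoint pruned box-sum halves at DIFFERENT floors -/

/-- ★ **THE E-SPINE AT TWO FLOORS**: the fcc half of `…HomPrunedPolar.homFloor_of_prunedBoxSums_selfAdjoint` at floor `m_F` and its hcp half at floor `m_H` give the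
TYPED floor — every admissible homogeneous instance REALISED BY AN fcc BALL of some `G` (`‖G − 1‖ ≤ 1/4`) scores `≥ m_F`, every one realised by an hcp ball of
some `(G, ξ)` (`‖ξ‖ ≤ 1/4`) scores `≥ m_H`.  Proof = the last two steps of the landed E-spine, kept per type: polar reduction to all `G`
(`prunedBoxSum_fcc/hcp_reduction`), the prune disjunct contradicts admissibility, the box sum IS the score (`ballAvg_xRec_eq_latticeSum_…`, `latticeSum_…_eq_boxSum_record`).
[folklore] -/
theorem typedFloor_of_prunedBoxSums_selfAdjoint {mF mH : ℝ}
    (hfcc : ∀ U : E3 →L[ℝ] E3, (∀ v w : E3, inner ℝ (U v) w = inner ℝ v (U w)) → (∀ w : E3, 0 ≤ inner ℝ w (U w)) → ‖U - 1‖ ≤ 1 / 4 →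
      (∀ (M : ℕ) (z : Fin M → E3) (c : Fin M), Function.Injective z →
          Set.range z = {x : E3 | dist x (z c) ≤ 133 / 10 ∧ ∃ a : Fin 3 → ℤ, x = z c + latPt U fccVec a} →
          TightNearCap (9 / 5) (3 / 2) z c ∨ ExemptNear (9 / 5) ExRec z c ∨ BadNearCap (9 / 5) (3 / 2) z c) ∨
      mF ≤ (∑ b ∈ (Fintype.piFinset fun _ : Fin 3 => Finset.Icc (-7 : ℤ) 7).filter (fun b => b ≠ 0),
        effPot w₄₅ ω₄ (3 / 400) ‖latPt U fccVec b‖) / 2 - (-(7175 / 10000) + 3 / 400))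
    (hhcp : ∀ (U : E3 →L[ℝ] E3) (ξ : E3), (∀ v w : E3, inner ℝ (U v) w = inner ℝ v (U w)) → (∀ w : E3, 0 ≤ inner ℝ w (U w)) →
      ‖U - 1‖ ≤ 1 / 4 → ‖ξ‖ ≤ 1 / 4 →
      (∀ (M : ℕ) (z : Fin M → E3) (c : Fin M), Function.Injective z →
          Set.range z = {x : E3 | dist x (z c) ≤ 133 / 10 ∧ ∃ a : Fin 3 → ℤ,
            x = z c + latPt U hexFrame a ∨ x = z c + latPt U hexFrame a + U (hcpShift + ξ)} →
          TightNearCap (9 / 5) (3 / 2) z c ∨ ExemptNear (9 / 5) ExRec z c ∨ BadNearCap (9 / 5) (3 / 2) z c) ∨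
      mH ≤ (∑ b ∈ (Fintype.piFinset fun _ : Fin 3 => Finset.Icc (-7 : ℤ) 7).filter (fun b => b ≠ 0),
          effPot w₄₅ ω₄ (3 / 400) ‖latPt U hexFrame b‖ +
        ∑ b ∈ (Fintype.piFinset fun _ : Fin 3 => Finset.Icc (-7 : ℤ) 7),
          effPot w₄₅ ω₄ (3 / 400) ‖latPt U hexFrame b + U (hcpShift + ξ)‖) / 2 - (-(7175 / 10000) + 3 / 400)) :
    ∀ (M : ℕ) (z : Fin M → E3) (c : Fin M), Admissible M z c → ∀ (G : E3 →L[ℝ] E3) (ξ : E3), ‖G - 1‖ ≤ 1 / 4 → ‖ξ‖ ≤ 1 / 4 →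
      (Set.range z = {x : E3 | dist x (z c) ≤ 133 / 10 ∧ ∃ a : Fin 3 → ℤ, x = z c + latPt G fccVec a} →
          mF ≤ ballAvg (9 / 5) z (xRec M z) c) ∧
        (Set.range z = {x : E3 | dist x (z c) ≤ 133 / 10 ∧ ∃ a : Fin 3 → ℤ,
            x = z c + latPt G hexFrame a ∨ x = z c + latPt G hexFrame a + G (hcpShift + ξ)} →
          mH ≤ ballAvg (9 / 5) z (xRec M z) c) := by
  intro M z c hA G ξ hG hξ
  constructor
  · intro hrange
    rcases prunedBoxSum_fcc_reduction hfcc G hG with hprune | hfloor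
    · rcases hprune M z c hA.1 hrange with hT | hE | hB
      · exact absurd hT hA.2.2.2.1
      · exact absurd hE hA.2.2.2.2.1
      · exact absurd hB hA.2.2.2.2.2
    · rw [ballAvg_xRec_eq_latticeSum_fcc hA hrange, latticeSum_fcc_eq_boxSum_record hG]
      exact hfloor
  · intro hrange
    rcases prunedBoxSum_hcp_reduction hhcp G ξ hG hξ with hprune | hfloor
    · rcases hprune M z c hA.1 hrange with hT | hE | hB
      · exact absurd hT hA.2.2.2.1
      · exact absurd hE hA.2.2.2.2.1
      · exact absurd hB hA.2.2.2.2.2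
    · rw [ballAvg_xRec_eq_latticeSum_hcp hA hrange, latticeSum_hcp_eq_boxSum_record hG hξ]
      exact hfloor

/-- The typed floor `(m_F, m_H)` gives the untyped floor `min m_F m_H` back. [folklore] -/
theorem homFloor_min_of_typedFloor {mF mH : ℝ}
    (h : ∀ (M : ℕ) (z : Fin M → E3) (c : Fin M), Admissible M z c → ∀ (G : E3 →L[ℝ] E3) (ξ : E3), ‖G - 1‖ ≤ 1 / 4 → ‖ξ‖ ≤ 1 / 4 →
      (Set.range z = {x : E3 | dist x (z c) ≤ 133 / 10 ∧ ∃ a : Fin 3 → ℤ, x = z c + latPt G fccVec a} →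
          mF ≤ ballAvg (9 / 5) z (xRec M z) c) ∧
        (Set.range z = {x : E3 | dist x (z c) ≤ 133 / 10 ∧ ∃ a : Fin 3 → ℤ,
            x = z c + latPt G hexFrame a ∨ x = z c + latPt G hexFrame a + G (hcpShift + ξ)} →
          mH ≤ ballAvg (9 / 5) z (xRec M z) c)) :
    HomFloor (min mF mH) := by
  rintro M z c hA ⟨G, ξ, hG, hξ, hrange | hrange⟩
  · exact (min_le_left mF mH).trans ((h M z c hA G ξ hG hξ).1 hrange)
  · exact (min_le_right mF mH).trans ((h M z c hA G ξ hG hξ).2 hrange)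

/-! ## §2 ★ The core-side reserve TYPED PER LATTICE -/

/-- ★ **TYPED GRADED CREDIT ⟹ TRUNCATED FLOOR**: typed floor `(m_F, m_H)` + «every admissible homogeneous instance realised by an fcc ball: far tail at `ρ` ≤ `−τ_F` ∨ `m′ ≤`
score; realised by an hcp ball: far tail ≤ `−τ_H` ∨ `m′ ≤` score» + `m′ ≤ m_F + τ_F` + `m′ ≤ m_H + τ_H` ⟹ `HomCoreFloor ρ m′` (`ρ ≥ 17/5`: the far tail is `≤ 0`).
[folklore: additivity of `ballAvg` + per-type case analysis] -/
theorem homCoreFloor_of_typedFloor_of_typedGradedCredit {ρ mF mH τF τH m' : ℝ} (hρ : 17 / 5 ≤ ρ)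
    (hH : ∀ (M : ℕ) (z : Fin M → E3) (c : Fin M), Admissible M z c → ∀ (G : E3 →L[ℝ] E3) (ξ : E3), ‖G - 1‖ ≤ 1 / 4 → ‖ξ‖ ≤ 1 / 4 →
      (Set.range z = {x : E3 | dist x (z c) ≤ 133 / 10 ∧ ∃ a : Fin 3 → ℤ, x = z c + latPt G fccVec a} →
          mF ≤ ballAvg (9 / 5) z (xRec M z) c) ∧
        (Set.range z = {x : E3 | dist x (z c) ≤ 133 / 10 ∧ ∃ a : Fin 3 → ℤ,
            x = z c + latPt G hexFrame a ∨ x = z c + latPt G hexFrame a + G (hcpShift + ξ)} →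
          mH ≤ ballAvg (9 / 5) z (xRec M z) c))
    (hτ : ∀ (M : ℕ) (z : Fin M → E3) (c : Fin M), Admissible M z c → ∀ (G : E3 →L[ℝ] E3) (ξ : E3), ‖G - 1‖ ≤ 1 / 4 → ‖ξ‖ ≤ 1 / 4 →
      (Set.range z = {x : E3 | dist x (z c) ≤ 133 / 10 ∧ ∃ a : Fin 3 → ℤ, x = z c + latPt G fccVec a} →
          ballAvg (9 / 5) z (tailOut ρ M z c) c ≤ -τF ∨ m' ≤ ballAvg (9 / 5) z (xRec M z) c) ∧
        (Set.range z = {x : E3 | dist x (z c) ≤ 133 / 10 ∧ ∃ a : Fin 3 → ℤ,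
            x = z c + latPt G hexFrame a ∨ x = z c + latPt G hexFrame a + G (hcpShift + ξ)} →
          ballAvg (9 / 5) z (tailOut ρ M z c) c ≤ -τH ∨ m' ≤ ballAvg (9 / 5) z (xRec M z) c))
    (hmF : m' ≤ mF + τF) (hmH : m' ≤ mH + τH) : HomCoreFloor ρ m' := by
  rintro M z c hA ⟨G, ξ, hG, hξ, hrange | hrange⟩
  · have h1 := (hH M z c hA G ξ hG hξ).1 hrange
    have h0 := ballAvg_tailOut_nonpos hρ z c
    rw [ballAvg_core_add_tail (R := ρ) z c] at h1
    rcases (hτ M z c hA G ξ hG hξ).1 hrange with h2 | h2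
    · linarith
    · rw [ballAvg_core_add_tail (R := ρ) z c] at h2
      linarith
  · have h1 := (hH M z c hA G ξ hG hξ).2 hrange
    have h0 := ballAvg_tailOut_nonpos hρ z c
    rw [ballAvg_core_add_tail (R := ρ) z c] at h1
    rcases (hτ M z c hA G ξ hG hξ).2 hrange with h2 | h2
    · linarith
    · rw [ballAvg_core_add_tail (R := ρ) z c] at h2
      linarith

/-- The untyped graded credit of `…Reserve` §1 is the typed one with `τ_F = τ_H = τ`. [formal bookkeeping] -/
theorem typedGradedCredit_of_gradedTailCredit {ρ τ m' : ℝ}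
    (hτ : ∀ (M : ℕ) (z : Fin M → E3) (c : Fin M), Admissible M z c → IsHomBall (133 / 10) z c →
      ballAvg (9 / 5) z (tailOut ρ M z c) c ≤ -τ ∨ m' ≤ ballAvg (9 / 5) z (xRec M z) c) :
    ∀ (M : ℕ) (z : Fin M → E3) (c : Fin M), Admissible M z c → ∀ (G : E3 →L[ℝ] E3) (ξ : E3), ‖G - 1‖ ≤ 1 / 4 → ‖ξ‖ ≤ 1 / 4 →
      (Set.range z = {x : E3 | dist x (z c) ≤ 133 / 10 ∧ ∃ a : Fin 3 → ℤ, x = z c + latPt G fccVec a} →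
          ballAvg (9 / 5) z (tailOut ρ M z c) c ≤ -τ ∨ m' ≤ ballAvg (9 / 5) z (xRec M z) c) ∧
        (Set.range z = {x : E3 | dist x (z c) ≤ 133 / 10 ∧ ∃ a : Fin 3 → ℤ,
            x = z c + latPt G hexFrame a ∨ x = z c + latPt G hexFrame a + G (hcpShift + ξ)} →
          ballAvg (9 / 5) z (tailOut ρ M z c) c ≤ -τ ∨ m' ≤ ballAvg (9 / 5) z (xRec M z) c) :=
  fun M z c hA G ξ hG hξ =>
    ⟨fun hrange => hτ M z c hA ⟨G, ξ, hG, hξ, Or.inl hrange⟩, fun hrange => hτ M z c hA ⟨G, ξ, hG, hξ, Or.inr hrange⟩⟩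

/-! ## §3 ★★ The typed floor from the production pair v3 at TWO certificate levels -/

/-- ★★ **SPLIT-LEVEL E-SPINE IN PRODUCTION CURRENCY**: an fcc ∃-tree over `entryLeafOK6RBKP μ_F` with `2 (m_F + e_W) SC ≤ μ_F` and an hcp ∃-tree over
`entryLeafOKHT4A2QQDCRS3 μ_H` with `2 (m_H + e_W) SC ≤ μ_H` give the typed floor `(m_F, m_H)`. [folklore chaining: `fccHalf_of_entryTree6RBKP`,
`hcpHalf_of_entryTreeHT4A2QQDCRS3`, §1] -/
theorem typedFloor_of_entryTreesHTA2QQDCRS3_splitLevel {mF mH : ℝ} {μF μH : ℤ}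
    (hμF : 2 * (mF + (-(7175 / 10000) + 3 / 400)) * SC ≤ μF) (hμH : 2 * (mH + (-(7175 / 10000) + 3 / 400)) * SC ≤ μH)
    (hFcc : ∃ t : CertTree (Fin 3 × Fin 3), treeOK (entryLeafOK6RBKP μF) t rootC rootW = true)
    (hHcp : ∃ t : CertTree ((Fin 3 × Fin 3) ⊕ Fin 3), treeOK (entryLeafOKHT4A2QQDCRS3 μH) t rootCH rootWH = true) :
    ∀ (M : ℕ) (z : Fin M → E3) (c : Fin M), Admissible M z c → ∀ (G : E3 →L[ℝ] E3) (ξ : E3), ‖G - 1‖ ≤ 1 / 4 → ‖ξ‖ ≤ 1 / 4 →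
      (Set.range z = {x : E3 | dist x (z c) ≤ 133 / 10 ∧ ∃ a : Fin 3 → ℤ, x = z c + latPt G fccVec a} →
          mF ≤ ballAvg (9 / 5) z (xRec M z) c) ∧
        (Set.range z = {x : E3 | dist x (z c) ≤ 133 / 10 ∧ ∃ a : Fin 3 → ℤ,
            x = z c + latPt G hexFrame a ∨ x = z c + latPt G hexFrame a + G (hcpShift + ξ)} →
          mH ≤ ballAvg (9 / 5) z (xRec M z) c) := by
  obtain ⟨tF, htF⟩ := hFcc
  obtain ⟨tH, htH⟩ := hHcp
  exact typedFloor_of_prunedBoxSums_selfAdjoint (fccHalf_of_entryTree6RBKP hμF htF) (hcpHalf_of_entryTreeHT4A2QQDCRS3 hμH htH)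

/-- ★ The untyped floor `min m_F m_H` from the split-level pair (no junction needs it; recorded for the census of floors). [folklore] -/
theorem homFloor_min_of_entryTreesHTA2QQDCRS3_splitLevel {mF mH : ℝ} {μF μH : ℤ}
    (hμF : 2 * (mF + (-(7175 / 10000) + 3 / 400)) * SC ≤ μF) (hμH : 2 * (mH + (-(7175 / 10000) + 3 / 400)) * SC ≤ μH)
    (hFcc : ∃ t : CertTree (Fin 3 × Fin 3), treeOK (entryLeafOK6RBKP μF) t rootC rootW = true)
    (hHcp : ∃ t : CertTree ((Fin 3 × Fin 3) ⊕ Fin 3), treeOK (entryLeafOKHT4A2QQDCRS3 μH) t rootCH rootWH = true) : HomFloor (min mF mH) :=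
  homFloor_min_of_typedFloor (typedFloor_of_entryTreesHTA2QQDCRS3_splitLevel hμF hμH hFcc hHcp)

/-! ## §4 ★★★ The crux from the split-level pair with the reserve typed per lattice -/

/-- ★★★ **27623, SPLIT-LEVEL PRODUCTION PAIR v3, TYPED RESERVE, IN-TUBE TAIL**: fcc ∃-tree at level `μ_F` (floor `m_F`) ∧ hcp ∃-tree at level `μ_H` (floor `m_H`) ∧ typed
graded credit `(τ_F, τ_H, m′)` at radius `ρ` ∧ `m′ ≤ m_F + τ_F` ∧ `m′ ≤ m_H + τ_H` ∧ (in-tube tail `≥ −μT`) ∧ CoreCoreRelief (63/10) (63/10) ρ ε A ∧ (A + μT ≤ m′) ∧ [CORE-FAR] ∧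
phase pieces ∧ defect pieces ∧ CC∪T₀ ∧ DD∪T₀ ∧ `0 ≤ D_X` ∧ Eopt-raw ⟹ crux (`ρ ≥ 17/5`, `φᵢ ≥ 0`, `ε_E ∈ (0, 10⁻⁴]`).  `…Truncated.aperiodicFrustratedLawGap_of_homCoreFloor_of_coreOff_tubeTail`
at `hH := homCoreFloor_of_typedFloor_of_typedGradedCredit …`. [folklore instantiation] -/
theorem aperiodicFrustratedLawGap_of_entryTreesHTA2QQDCRS3_splitLevel_of_typedGradedCredit_of_coreOff_tubeTail {μF μH : ℤ}
    {ρ ε mF mH τF τH m' μT A φ₁ φ₂ φ₃ εE CE DE DX : ℝ}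
    (hε0 : 0 < εE) (hε1 : εE ≤ 1 / 10000) (hDX : 0 ≤ DX)
    (hE : SchurElasticPricingX (1 / 20) (1 / 8) w₄₅ ω₄ (3 / 400) (-(7175 / 10000)) (1 / 10000) CE DE DX (LocOptFails eStar εE (3 / 2) 1))
    (hμF : 2 * (mF + (-(7175 / 10000) + 3 / 400)) * SC ≤ μF) (hμH : 2 * (mH + (-(7175 / 10000) + 3 / 400)) * SC ≤ μH)
    (hFcc : ∃ t : CertTree (Fin 3 × Fin 3), treeOK (entryLeafOK6RBKP μF) t rootC rootW = true)
    (hHcp : ∃ t : CertTree ((Fin 3 × Fin 3) ⊕ Fin 3), treeOK (entryLeafOKHT4A2QQDCRS3 μH) t rootCH rootWH = true)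
    (hρ : 17 / 5 ≤ ρ)
    (hτ : ∀ (M : ℕ) (z : Fin M → E3) (c : Fin M), Admissible M z c → ∀ (G : E3 →L[ℝ] E3) (ξ : E3), ‖G - 1‖ ≤ 1 / 4 → ‖ξ‖ ≤ 1 / 4 →
      (Set.range z = {x : E3 | dist x (z c) ≤ 133 / 10 ∧ ∃ a : Fin 3 → ℤ, x = z c + latPt G fccVec a} →
          ballAvg (9 / 5) z (tailOut ρ M z c) c ≤ -τF ∨ m' ≤ ballAvg (9 / 5) z (xRec M z) c) ∧
        (Set.range z = {x : E3 | dist x (z c) ≤ 133 / 10 ∧ ∃ a : Fin 3 → ℤ,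
            x = z c + latPt G hexFrame a ∨ x = z c + latPt G hexFrame a + G (hcpShift + ξ)} →
          ballAvg (9 / 5) z (tailOut ρ M z c) c ≤ -τH ∨ m' ≤ ballAvg (9 / 5) z (xRec M z) c))
    (hmF : m' ≤ mF + τF) (hmH : m' ≤ mH + τH)
    (hT : ∀ (M : ℕ) (z : Fin M → E3) (c : Fin M), Admissible M z c → CleanBall (63 / 10) z c → MonoPhaseBall (63 / 10) z c → NearHomIsoAt ρ ε z c →
      -μT ≤ ballAvg (9 / 5) z (tailOut ρ M z c) c)
    (hR : CoreCoreRelief (63 / 10) (63 / 10) ρ ε A) (hm : A + μT ≤ m')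
    (hC : CoreOffTubeFloor (63 / 10) (63 / 10) ρ ε φ₁) (hF : AnnularPhaseFloor (63 / 10) (24 / 5) (63 / 10) φ₂)
    (hP : PolyTextureFloor (63 / 10) (24 / 5) φ₃) (h₁ : 0 ≤ φ₁) (h₂ : 0 ≤ φ₂) (h₃ : 0 ≤ φ₃) (hA : AnnularDefectFloor (24 / 5) (63 / 10))
    (hD : DefectiveCollarFloor (24 / 5))
    (h2 : CrowdedCoreMotifPricingCapK (1 / 1000) (9 / 5) (133 / 10) (3 / 2) (effPot w₄₅ ω₄ (3 / 400)) (-(7175 / 10000) + 3 / 400)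
      (Collar (9 / 2) fun N y j => (∃ s : ℝ, 0 ≤ s ∧ s ≤ 3 / 2 ∧ NonEquilibriumCore (-(7175 / 10000)) 0 7 s (1 / 10000) N y j) ∨
        GoodAtScale (1 / 20) (3 / 2) y j))
    (h3 : DiluteDefectMotifPricingCapK (1 / 1000) (9 / 5) (133 / 10) (3 / 2) (effPot w₄₅ ω₄ (3 / 400)) (-(7175 / 10000) + 3 / 400)
      (Collar (9 / 2) fun N y j => (∃ s : ℝ, 0 ≤ s ∧ s ≤ 3 / 2 ∧ NonEquilibriumCore (-(7175 / 10000)) 0 7 s (1 / 10000) N y j) ∨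
        GoodAtScale (1 / 20) (3 / 2) y j)) :
    Summit.AtomisticToContinuum.Crystallization.Theses.FrustratedLawDichotomy.AperiodicFrustratedLawGap :=
  aperiodicFrustratedLawGap_of_homCoreFloor_of_coreOff_tubeTail hε0 hε1 periodicEnergyCeiling_holds hDX hE
    (homCoreFloor_of_typedFloor_of_typedGradedCredit hρ (typedFloor_of_entryTreesHTA2QQDCRS3_splitLevel hμF hμH hFcc hHcp) hτ hmF hmH)
    hT hR hm hC hF hP h₁ h₂ h₃ hA hD h2 h3

/-- ★★★ **THE SPLIT RESERVE AT THE RECORD T-SIDE**: for reserves `r_F`, `r_H` and levels `μ_F`, `μ_H` with `2 ((1/625 − r_F) + e_W) SC ≤ μ_F`, `2 ((1/625 − r_H) + e_W) SC ≤ μ_H`: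
fcc ∃-tree at `μ_F` (the fcc half certified at the floor `1/625 − r_F`) ∧ hcp ∃-tree at `μ_H` (hcp half at `1/625 − r_H`) ∧ typed graded credit «fcc-realised: tail(24/5) ≤ `−r_F` ∨
`1/625 ≤` score; hcp-realised: tail(24/5) ≤ `−r_H` ∨ `1/625 ≤` score» ∧ the TEN record T-leaves VERBATIM ∧ `0 ≤ D_X` ∧ Eopt-raw ⟹ crux. [folklore instantiation] -/
theorem aperiodicFrustratedLawGap_of_entryTreesHTA2QQDCRS3_splitReserve_record {μF μH : ℤ} {rF rH εE CE DE DX : ℝ}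
    (hε0 : 0 < εE) (hε1 : εE ≤ 1 / 10000) (hDX : 0 ≤ DX)
    (hE : SchurElasticPricingX (1 / 20) (1 / 8) w₄₅ ω₄ (3 / 400) (-(7175 / 10000)) (1 / 10000) CE DE DX (LocOptFails eStar εE (3 / 2) 1))
    (hμF : 2 * ((1 / 625 - rF) + (-(7175 / 10000) + 3 / 400)) * SC ≤ μF) (hμH : 2 * ((1 / 625 - rH) + (-(7175 / 10000) + 3 / 400)) * SC ≤ μH)
    (hFcc : ∃ t : CertTree (Fin 3 × Fin 3), treeOK (entryLeafOK6RBKP μF) t rootC rootW = true)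
    (hHcp : ∃ t : CertTree ((Fin 3 × Fin 3) ⊕ Fin 3), treeOK (entryLeafOKHT4A2QQDCRS3 μH) t rootCH rootWH = true)
    (hτ : ∀ (M : ℕ) (z : Fin M → E3) (c : Fin M), Admissible M z c → ∀ (G : E3 →L[ℝ] E3) (ξ : E3), ‖G - 1‖ ≤ 1 / 4 → ‖ξ‖ ≤ 1 / 4 →
      (Set.range z = {x : E3 | dist x (z c) ≤ 133 / 10 ∧ ∃ a : Fin 3 → ℤ, x = z c + latPt G fccVec a} →
          ballAvg (9 / 5) z (tailOut (24 / 5) M z c) c ≤ -rF ∨ 1 / 625 ≤ ballAvg (9 / 5) z (xRec M z) c) ∧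
        (Set.range z = {x : E3 | dist x (z c) ≤ 133 / 10 ∧ ∃ a : Fin 3 → ℤ,
            x = z c + latPt G hexFrame a ∨ x = z c + latPt G hexFrame a + G (hcpShift + ξ)} →
          ballAvg (9 / 5) z (tailOut (24 / 5) M z c) c ≤ -rH ∨ 1 / 625 ≤ ballAvg (9 / 5) z (xRec M z) c))
    (hT : ∀ (M : ℕ) (z : Fin M → E3) (c : Fin M), Admissible M z c → CleanBall (63 / 10) z c → MonoPhaseBall (63 / 10) z c →
      NearHomIsoAt (24 / 5) (1 / 100) z c → -(1 / 1000) ≤ ballAvg (9 / 5) z (tailOut (24 / 5) M z c) c)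
    (hRl : CoreCoreRelief (63 / 10) (63 / 10) (24 / 5) (1 / 100) (3 / 5000))
    (hC : CoreOffTubeFloor (63 / 10) (63 / 10) (24 / 5) (1 / 100) 0) (hF : AnnularPhaseFloor (63 / 10) (24 / 5) (63 / 10) (1 / 1000))
    (hP : PolyTextureFloor (63 / 10) (24 / 5) (1 / 1000)) (hA : AnnularDefectFloor (24 / 5) (63 / 10)) (hD : DefectiveCollarFloor (24 / 5))
    (h2 : CrowdedCoreMotifPricingCapK (1 / 1000) (9 / 5) (133 / 10) (3 / 2) (effPot w₄₅ ω₄ (3 / 400)) (-(7175 / 10000) + 3 / 400)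
      (Collar (9 / 2) fun N y j => (∃ s : ℝ, 0 ≤ s ∧ s ≤ 3 / 2 ∧ NonEquilibriumCore (-(7175 / 10000)) 0 7 s (1 / 10000) N y j) ∨
        GoodAtScale (1 / 20) (3 / 2) y j))
    (h3 : DiluteDefectMotifPricingCapK (1 / 1000) (9 / 5) (133 / 10) (3 / 2) (effPot w₄₅ ω₄ (3 / 400)) (-(7175 / 10000) + 3 / 400)
      (Collar (9 / 2) fun N y j => (∃ s : ℝ, 0 ≤ s ∧ s ≤ 3 / 2 ∧ NonEquilibriumCore (-(7175 / 10000)) 0 7 s (1 / 10000) N y j) ∨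
        GoodAtScale (1 / 20) (3 / 2) y j)) :
    Summit.AtomisticToContinuum.Crystallization.Theses.FrustratedLawDichotomy.AperiodicFrustratedLawGap :=
  aperiodicFrustratedLawGap_of_entryTreesHTA2QQDCRS3_splitLevel_of_typedGradedCredit_of_coreOff_tubeTail (m' := 1 / 625) hε0 hε1 hDX hE hμF hμH
    hFcc hHcp (by norm_num) hτ (by linarith) (by linarith) hT hRl seam_arith_core hC hF hP le_rfl (by norm_num) (by norm_num) hA hD h2 h3

/- ★ NUMERAL INSTANCE (an `example`): `(r_F, r_H) = (13/25000, 1/2500)` at the certified levels `μ₅₂ = −399086480979436` (fcc) / `μ₄₀ = −399018926985025` (hcp) of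
`…Reserve` §4/§5 (`level_ok_reserve52`, `level_ok_reserve40`) — the fcc half certified at the floor `27/25000`, the hcp half at `3/2500`. -/
example {εE CE DE DX : ℝ}
    (hε0 : 0 < εE) (hε1 : εE ≤ 1 / 10000) (hDX : 0 ≤ DX)
    (hE : SchurElasticPricingX (1 / 20) (1 / 8) w₄₅ ω₄ (3 / 400) (-(7175 / 10000)) (1 / 10000) CE DE DX (LocOptFails eStar εE (3 / 2) 1))
    (hFcc : ∃ t : CertTree (Fin 3 × Fin 3), treeOK (entryLeafOK6RBKP (-399086480979436)) t rootC rootW = true)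
    (hHcp : ∃ t : CertTree ((Fin 3 × Fin 3) ⊕ Fin 3), treeOK (entryLeafOKHT4A2QQDCRS3 (-399018926985025)) t rootCH rootWH = true)
    (hτ : ∀ (M : ℕ) (z : Fin M → E3) (c : Fin M), Admissible M z c → ∀ (G : E3 →L[ℝ] E3) (ξ : E3), ‖G - 1‖ ≤ 1 / 4 → ‖ξ‖ ≤ 1 / 4 →
      (Set.range z = {x : E3 | dist x (z c) ≤ 133 / 10 ∧ ∃ a : Fin 3 → ℤ, x = z c + latPt G fccVec a} →
          ballAvg (9 / 5) z (tailOut (24 / 5) M z c) c ≤ -(13 / 25000) ∨ 1 / 625 ≤ ballAvg (9 / 5) z (xRec M z) c) ∧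
        (Set.range z = {x : E3 | dist x (z c) ≤ 133 / 10 ∧ ∃ a : Fin 3 → ℤ,
            x = z c + latPt G hexFrame a ∨ x = z c + latPt G hexFrame a + G (hcpShift + ξ)} →
          ballAvg (9 / 5) z (tailOut (24 / 5) M z c) c ≤ -(1 / 2500) ∨ 1 / 625 ≤ ballAvg (9 / 5) z (xRec M z) c))
    (hT : ∀ (M : ℕ) (z : Fin M → E3) (c : Fin M), Admissible M z c → CleanBall (63 / 10) z c → MonoPhaseBall (63 / 10) z c →
      NearHomIsoAt (24 / 5) (1 / 100) z c → -(1 / 1000) ≤ ballAvg (9 / 5) z (tailOut (24 / 5) M z c) c)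
    (hRl : CoreCoreRelief (63 / 10) (63 / 10) (24 / 5) (1 / 100) (3 / 5000))
    (hC : CoreOffTubeFloor (63 / 10) (63 / 10) (24 / 5) (1 / 100) 0) (hF : AnnularPhaseFloor (63 / 10) (24 / 5) (63 / 10) (1 / 1000))
    (hP : PolyTextureFloor (63 / 10) (24 / 5) (1 / 1000)) (hA : AnnularDefectFloor (24 / 5) (63 / 10)) (hD : DefectiveCollarFloor (24 / 5))
    (h2 : CrowdedCoreMotifPricingCapK (1 / 1000) (9 / 5) (133 / 10) (3 / 2) (effPot w₄₅ ω₄ (3 / 400)) (-(7175 / 10000) + 3 / 400)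
      (Collar (9 / 2) fun N y j => (∃ s : ℝ, 0 ≤ s ∧ s ≤ 3 / 2 ∧ NonEquilibriumCore (-(7175 / 10000)) 0 7 s (1 / 10000) N y j) ∨
        GoodAtScale (1 / 20) (3 / 2) y j))
    (h3 : DiluteDefectMotifPricingCapK (1 / 1000) (9 / 5) (133 / 10) (3 / 2) (effPot w₄₅ ω₄ (3 / 400)) (-(7175 / 10000) + 3 / 400)
      (Collar (9 / 2) fun N y j => (∃ s : ℝ, 0 ≤ s ∧ s ≤ 3 / 2 ∧ NonEquilibriumCore (-(7175 / 10000)) 0 7 s (1 / 10000) N y j) ∨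
        GoodAtScale (1 / 20) (3 / 2) y j)) :
    Summit.AtomisticToContinuum.Crystallization.Theses.FrustratedLawDichotomy.AperiodicFrustratedLawGap :=
  aperiodicFrustratedLawGap_of_entryTreesHTA2QQDCRS3_splitReserve_record hε0 hε1 hDX hE level_ok_reserve52 level_ok_reserve40 hFcc hHcp hτ hT hRl hC hF hP
    hA hD h2 h3

/-! ## §5 Consistency of the reserve routes with the record floor, and the safe uniform reserve `r = 4.5e-4` (appended by hand-2 g38; FINDING RESERVE rev 2) -/

/-- ★ **THE RESERVE ROUTE IS NEVER HARDER THAN THE RECORD ROUTE**: the record floor `HomFloor m′` implies the graded tail credit `(τ, m′)` for EVERY `τ` and radius `ρ`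
(second disjunct everywhere) — so `…Reserve.…_reserve_record`'s side hypothesis is TRUE whenever the junction of record's `(H)` is, and the dial `r` only prices it. [folklore] -/
theorem gradedTailCredit_of_homFloor {ρ m' : ℝ} (τ : ℝ) (hH : HomFloor m') :
    ∀ (M : ℕ) (z : Fin M → E3) (c : Fin M), Admissible M z c → IsHomBall (133 / 10) z c →
      ballAvg (9 / 5) z (tailOut ρ M z c) c ≤ -τ ∨ m' ≤ ballAvg (9 / 5) z (xRec M z) c :=
  fun M z c hz hhom => Or.inr (hH M z c hz hhom)

/-- The typed credit likewise follows from the typed floor at `m′` (both types). [folklore] -/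
theorem typedGradedCredit_of_typedFloor {ρ m' : ℝ} (τF τH : ℝ)
    (hH : ∀ (M : ℕ) (z : Fin M → E3) (c : Fin M), Admissible M z c → ∀ (G : E3 →L[ℝ] E3) (ξ : E3), ‖G - 1‖ ≤ 1 / 4 → ‖ξ‖ ≤ 1 / 4 →
      (Set.range z = {x : E3 | dist x (z c) ≤ 133 / 10 ∧ ∃ a : Fin 3 → ℤ, x = z c + latPt G fccVec a} →
          m' ≤ ballAvg (9 / 5) z (xRec M z) c) ∧
        (Set.range z = {x : E3 | dist x (z c) ≤ 133 / 10 ∧ ∃ a : Fin 3 → ℤ,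
            x = z c + latPt G hexFrame a ∨ x = z c + latPt G hexFrame a + G (hcpShift + ξ)} →
          m' ≤ ballAvg (9 / 5) z (xRec M z) c)) :
    ∀ (M : ℕ) (z : Fin M → E3) (c : Fin M), Admissible M z c → ∀ (G : E3 →L[ℝ] E3) (ξ : E3), ‖G - 1‖ ≤ 1 / 4 → ‖ξ‖ ≤ 1 / 4 →
      (Set.range z = {x : E3 | dist x (z c) ≤ 133 / 10 ∧ ∃ a : Fin 3 → ℤ, x = z c + latPt G fccVec a} →
          ballAvg (9 / 5) z (tailOut ρ M z c) c ≤ -τF ∨ m' ≤ ballAvg (9 / 5) z (xRec M z) c) ∧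
        (Set.range z = {x : E3 | dist x (z c) ≤ 133 / 10 ∧ ∃ a : Fin 3 → ℤ,
            x = z c + latPt G hexFrame a ∨ x = z c + latPt G hexFrame a + G (hcpShift + ξ)} →
          ballAvg (9 / 5) z (tailOut ρ M z c) c ≤ -τH ∨ m' ≤ ballAvg (9 / 5) z (xRec M z) c) :=
  fun M z c hA G ξ hG hξ =>
    ⟨fun hrange => Or.inr ((hH M z c hA G ξ hG hξ).1 hrange), fun hrange => Or.inr ((hH M z c hA G ξ hG hξ).2 hrange)⟩

/-- The safe uniform kernel-free reserve `r = 4.5e-4 = 9/20000` (RESERVE rev 2: sheared binding-type hcp hosts have far tails `≤ −5.0e-4`; `4.5e-4` keeps ≥ 10 % margin): floor `23/20000`,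
certified integer level `μ₄₅ = −399047074482697` (`2 (23/20000 + e_W) SC = −399047074482697.02…`). [formal bookkeeping] -/
theorem level_ok_reserve45 : 2 * (((1 : ℝ) / 625 - 9 / 20000) + (-(7175 / 10000) + 3 / 400)) * SC ≤ ((-399047074482697 : ℤ) : ℝ) := by
  norm_num [SC]

/-- ★★ **DESIGNATE COROLLARY, uniform reserve `r = 4.5e-4`**: trees over `entryLeafOK6RBKP / entryLeafOKHT4A2QQDCRS3 (−399047074482697)` (H floor `23/20000`) ∧ graded credit
«tail(24/5) ≤ −9/20000 ∨ 1/625 ≤ score» ∧ the TEN record T-leaves VERBATIM ⟹ crux (`…Reserve.…_reserve_record` at `level_ok_reserve45`). [folklore instantiation] -/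
theorem aperiodicFrustratedLawGap_of_entryTreesHTA2QQDCRS3_reserve45_record {εE CE DE DX : ℝ}
    (hε0 : 0 < εE) (hε1 : εE ≤ 1 / 10000) (hDX : 0 ≤ DX)
    (hE : SchurElasticPricingX (1 / 20) (1 / 8) w₄₅ ω₄ (3 / 400) (-(7175 / 10000)) (1 / 10000) CE DE DX (LocOptFails eStar εE (3 / 2) 1))
    (hFcc : ∃ t : CertTree (Fin 3 × Fin 3), treeOK (entryLeafOK6RBKP (-399047074482697)) t rootC rootW = true)
    (hHcp : ∃ t : CertTree ((Fin 3 × Fin 3) ⊕ Fin 3), treeOK (entryLeafOKHT4A2QQDCRS3 (-399047074482697)) t rootCH rootWH = true)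
    (hτ : ∀ (M : ℕ) (z : Fin M → E3) (c : Fin M), Admissible M z c → IsHomBall (133 / 10) z c →
      ballAvg (9 / 5) z (tailOut (24 / 5) M z c) c ≤ -(9 / 20000) ∨ 1 / 625 ≤ ballAvg (9 / 5) z (xRec M z) c)
    (hT : ∀ (M : ℕ) (z : Fin M → E3) (c : Fin M), Admissible M z c → CleanBall (63 / 10) z c → MonoPhaseBall (63 / 10) z c →
      NearHomIsoAt (24 / 5) (1 / 100) z c → -(1 / 1000) ≤ ballAvg (9 / 5) z (tailOut (24 / 5) M z c) c)
    (hRl : CoreCoreRelief (63 / 10) (63 / 10) (24 / 5) (1 / 100) (3 / 5000))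
    (hC : CoreOffTubeFloor (63 / 10) (63 / 10) (24 / 5) (1 / 100) 0) (hF : AnnularPhaseFloor (63 / 10) (24 / 5) (63 / 10) (1 / 1000))
    (hP : PolyTextureFloor (63 / 10) (24 / 5) (1 / 1000)) (hA : AnnularDefectFloor (24 / 5) (63 / 10)) (hD : DefectiveCollarFloor (24 / 5))
    (h2 : CrowdedCoreMotifPricingCapK (1 / 1000) (9 / 5) (133 / 10) (3 / 2) (effPot w₄₅ ω₄ (3 / 400)) (-(7175 / 10000) + 3 / 400)
      (Collar (9 / 2) fun N y j => (∃ s : ℝ, 0 ≤ s ∧ s ≤ 3 / 2 ∧ NonEquilibriumCore (-(7175 / 10000)) 0 7 s (1 / 10000) N y j) ∨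
        GoodAtScale (1 / 20) (3 / 2) y j))
    (h3 : DiluteDefectMotifPricingCapK (1 / 1000) (9 / 5) (133 / 10) (3 / 2) (effPot w₄₅ ω₄ (3 / 400)) (-(7175 / 10000) + 3 / 400)
      (Collar (9 / 2) fun N y j => (∃ s : ℝ, 0 ≤ s ∧ s ≤ 3 / 2 ∧ NonEquilibriumCore (-(7175 / 10000)) 0 7 s (1 / 10000) N y j) ∨
        GoodAtScale (1 / 20) (3 / 2) y j)) :
    Summit.AtomisticToContinuum.Crystallization.Theses.FrustratedLawDichotomy.AperiodicFrustratedLawGap :=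
  aperiodicFrustratedLawGap_of_entryTreesHTA2QQDCRS3_reserve_record hε0 hε1 hDX hE level_ok_reserve45 hFcc hHcp hτ hT hRl hC hF hP hA hD h2 h3

end Summit.AtomisticToContinuum.Crystallization.Theorems.FrustratedLawDichotomyAperiodicGapRecordJunctionSplitLevel

end
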